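import Mathlib

/-!
# STUB-IDEAS k2 (gen 25) — sketch for `stub_heegnerIndexLowerAtTwo`
## «(2)₂'s constant is KEY-ONLY by MULTIPLICITY ONE of the twisted local Iwasawa module at `v`»

Crux `SplitBadTwoLowerHalfOfFacts` (stmt-BirchSwinnertonDyer-27851), route PrintCf2, stub
`stub_heegnerIndexLowerAtTwo` (skeleton `Lines/heegner_index_two_lower.lean`).  Road RT
(k1-g16 / k3-g21; STUB-PLAN v4.7 §4) is the only producer of the HARDEST node (a-∃)
(`KatzRubinValueAtTwo` : `∃ eA : ℤ → ℤ → ℤ, ∀ frames …`).  Its node (2)₂ `OutOfRangeLogLaw`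
was CUT by k3-g24 into atoms A (`KLFMasses`/`KLFValue`, print) / **B** (`TwistedKummerLogLaw
F E : F.logLoc = E * F.Ω * F.unitLog.integral F.ρ`, LOAD-BEARING, «local Saito–Masser» —
an explicit reciprocity law at 2 for a ramified twist) / C (dictionary).

THIS SKETCH: atom B is needed only UNIFORMLY IN THE KEY, not with an explicit `E`.  Both
sides of B are `ρ`-semilinear functionals on ONE module — the (Kummer image of the) norm-
coherent principal units `U_∞(T(key))` of the local tower `T(key) = ℚ₂^{nr,2^∞}·ℚ₂(√d)`
(the dyadic key of `W = A^{(d)}` IS the ramified quadratic field `ℚ₂(√d)`), over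
`Λ(key) = ℤ₂⟦Gal(T(key)/ℚ₂)⟧`, for the character `ρ = (Frob ↦ ψ̄_A(𝔭)) ⊗ sgn_{ℚ₂(√d)}`:
  * `logTw u = log_ω (tw_ρ u)` — descent `H¹_Iw(ℚ₂, ℤ₂(1))_ρ → H¹(ℚ₂, ℤ₂(1)(ρ⁻¹)) = H¹(ℚ₂, T_𝔭W)`
    (Nekovář, Selmer Complexes, Cor. 8.4.8.2 (i); de Shalit II.4.3 (8)–(10) for
    `T_𝔭W|_{G_{ℚ₂}} ≅ ℤ₂(1) ⊗ ρ⁻¹`), then `H¹ = H¹_f = W(ℚ₂) ⊗̂ ℚ₂` (Bloch–Kato Cor. 3.8.4,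
    Ex. 3.10.1, (3.11)) and `log_ω`;
  * `lam u = ∫ ρ dμ_{log u}` — the Riemann-sum functional of the tree
    (`GroupDistribution.tendsto_riemannSum_integral`), i.e. k3-g24's `F.unitLog.integral F.ρ`.
MULTIPLICITY ONE (`dim (U_∞ ⊗_{Λ,ρ} 𝕜) = 1`: `U_∞(T(key)) ↪ Λ²` with finite index and no
Λ-torsion by Greenberg, Iwasawa theory for p-adic representations, Prop. 1 + Cor. 1 (`K = ℚ₂(√d)`,
`A = ℚ₂/ℤ₂`, `A*(K_∞) = μ_{2^∞}(ℚ₂(√d))` finite; any `ℤ_p`-extension, any `p`) — equivalently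
Nekovář 8.11.5 (ii), Rubin 1992 Thm 7.2 (i)'s shape at p = 2 —, descent injective (Nekovář
8.4.8.2 (i)), `dim H¹(ℚ₂, ℚ₂(1)(ρ⁻¹)) = 1` (Tate's local Euler–Poincaré formula)) ⟹ `logTw = C(key) · lam` on the whole
module, hence `TwistedKummerLogLaw F_W (C(key)/Ω)` for EVERY member `W` of the key class —
with NO explicit reciprocity law.  The VALUE of `C(key)` (Rubin's `N(𝔣)⁻¹(p−1)(1−ψ*(𝔭)/p)·Ω_p`-
type constant) is NOT produced here; (a-∃) quantifies `∃ eA` outside the frames and does not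
need it; pinning `eA(key)` stays with the α-bit producers / anchors of v4.7.

Contents (all kernel-checked, 0 sorry; no instances, no notation):
§1 abstract multiplicity-one core over a commutative ring `R`, a field `k`, a character
   `χ : R →+* k` and `χ`-semilinear additive functionals;  §2 the «Rubin shape»: rank one +
   no `a`-torsion + factorisation `s = aⁿ·s'` ⟹ cyclic-up-to-`χ` (how Nekovář 8.11.5 (ii) /
   Rubin 7.2 (i) feed §1);  §3 the linear-algebra avatars (dual of a `≤ 1`-dimensional space;
   Euler–Poincaré bookkeeping; `H¹_f = H¹`);  §4 the typed receptacle `LocalTwistPackage` (one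
   per dyadic key) and `Member` (one per curve of the key class) with the UNIFORM laws
   `twistedKummerLogLaw_uniform`, `outOfRangeLogLaw_uniform`, `norm_logLoc_uniform`;
   §5 a model (non-vacuity) and the necessity of the multiplicity-one hypothesis.

BSD is NOT proved by any of this; nothing here touches the route's `closes`, the skeleton or
its stubs.
-/

namespace Summit.BirchSwinnertonDyer.BirchSwinnertonDyer.Cruxes.SplitBadTwoLowerHalfOfFacts.MultOneK2G25

/-! ## §1  Multiplicity one, abstractly -/

section Core

variable {R : Type*} [CommRing R] {k : Type*} [Field k] {M : Type*} [AddCommGroup M] [Module R M]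

/-- `f` is a `χ`-semilinear functional: `f (r • m) = χ r * f m`.  (Both `log_ω ∘ tw_ρ` and
`u ↦ ∫ ρ dμ_{log u}` are of this shape for `χ = ρ : Λ(key) → 𝕜`.) -/
def IsCharFunctional (χ : R →+* k) (f : M →+ k) : Prop :=
  ∀ (r : R) (m : M), f (r • m) = χ r * f m

/-- «`M` is cyclic up to `χ`-regular denominators, generated by `m₀`»: every `m` satisfies
`s • m = r • m₀` with `χ s ≠ 0`.  This is the usable form of
`dim_k (k ⊗_{R,χ} M) = 1 with 1 ⊗ m₀ ≠ 0` (N1, multiplicity one). -/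
def CyclicUpToChar (χ : R →+* k) (m₀ : M) : Prop :=
  ∀ m : M, ∃ s r : R, χ s ≠ 0 ∧ s • m = r • m₀

/-- Evaluation formula: a `χ`-functional is determined by its value on the generator. -/
theorem IsCharFunctional.apply_mul_eq {χ : R →+* k} {f : M →+ k} (hf : IsCharFunctional χ f)
    {m m₀ : M} {s r : R} (h : s • m = r • m₀) :
    χ s * f m = χ r * f m₀ := by
  rw [← hf, ← hf, h]

/-- A `χ`-functional vanishing on the generator vanishes identically. -/
theorem IsCharFunctional.eq_zero_of_apply_gen {χ : R →+* k} {m₀ : M}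
    (hcyc : CyclicUpToChar χ m₀) {f : M →+ k} (hf : IsCharFunctional χ f) (h0 : f m₀ = 0) :
    ∀ m, f m = 0 := by
  intro m
  obtain ⟨s, r, hs, h⟩ := hcyc m
  have key := hf.apply_mul_eq h
  rw [h0, mul_zero] at key
  exact (mul_eq_zero.mp key).resolve_left hs

/-- **Multiplicity one ⟹ proportionality.**  Two `χ`-semilinear functionals on a module that is
cyclic up to `χ`-regular denominators are proportional; the constant is `f m₀ / g m₀`.
Application: `f = log_ω ∘ tw_ρ`, `g = ∫ ρ dμ_{log ·}` on `U_∞(T(key))` ⟹ ONE constant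
`C(key)` with `log_ω(loc_v z_W) = C(key) · ∫ ρ_W d(unitLog_W)` for every member `W` of the key
class (k3-g24's atom B, uniformly, without an explicit reciprocity law). -/
theorem proportional_of_cyclicUpToChar {χ : R →+* k} {m₀ : M} (hcyc : CyclicUpToChar χ m₀)
    {f g : M →+ k} (hf : IsCharFunctional χ f) (hg : IsCharFunctional χ g) (hg0 : g m₀ ≠ 0) :
    ∃ C : k, ∀ m, f m = C * g m := by
  refine ⟨f m₀ / g m₀, fun m => ?_⟩
  obtain ⟨s, r, hs, h⟩ := hcyc m
  have kf := hf.apply_mul_eq h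
  have kg := hg.apply_mul_eq h
  -- `χ s * f m = χ r * f m₀` and `χ s * g m = χ r * g m₀`
  have key : χ s * (f m * g m₀) = χ s * (f m₀ * g m) := by
    calc χ s * (f m * g m₀) = (χ s * f m) * g m₀ := by ring
      _ = χ r * f m₀ * g m₀ := by rw [kf]
      _ = f m₀ * (χ r * g m₀) := by ring
      _ = f m₀ * (χ s * g m) := by rw [kg]
      _ = χ s * (f m₀ * g m) := by ring
  have h2 : f m * g m₀ = f m₀ * g m := mul_left_cancel₀ hs key
  rw [div_mul_eq_mul_div, eq_div_iff hg0]
  exact h2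

omit [Module R M] in
/-- The proportionality constant is unique (given a vector where `g ≠ 0`). -/
theorem proportional_const_unique {m₀ : M} {f g : M →+ k} (hg0 : g m₀ ≠ 0)
    {C C' : k} (hC : ∀ m, f m = C * g m) (hC' : ∀ m, f m = C' * g m) : C = C' := by
  have := (hC m₀).symm.trans (hC' m₀)
  exact mul_right_cancel₀ hg0 this

omit [Module R M] in
/-- The constant is non-zero iff `f` does not vanish on the generator (⟸ descent is an
isomorphism integrally and `log_ω` is injective on `W(ℚ₂) ⊗ ℚ`, see N3). -/
theorem proportional_const_ne_zero {m₀ : M} {f g : M →+ k}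
    {C : k} (hC : ∀ m, f m = C * g m) (hf0 : f m₀ ≠ 0) : C ≠ 0 := by
  intro hC0
  apply hf0
  rw [hC m₀, hC0, zero_mul]

end Core

/-! ## §2  The «Rubin shape»: rank one + no `a`-torsion ⟹ cyclic up to `χ`

How the print facts feed §1: `R = Λ(key)` (after projecting to the `sgn`-part, a power-series
ring `ℤ₂⟦T⟧` or its `ℚ₂`-span), `a = γ − ρ(γ)⁻¹` (so `χ a = 0`), `hfac` = «every non-zero power
series is `(T−c)ⁿ · h` with `h(c) ≠ 0`», `htor` = «`U_∞` has no `a`-torsion» (Nekovář 8.11.5 (ii):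
the Λ-torsion of `H¹_Iw(T)` is `H⁰(G_{F_∞}, T)`, which is `0` for `T = ℤ₂(1)` over `T(key)` since
`T(key) ∩ ℚ₂(μ_{2^∞})` is finite; = Greenberg Cor. 1 «`A*(K_∞)` finite ⟹ `X` has no Λ-torsion»
— Rubin 1992 Thm 7.2 (i)'s «no ϑ*-torsion» at p = 2), `hrk` = «Λ-rank one per sign» (Greenberg
Prop. 1 / Cor. 1: `X ↪ Λ^{[K:ℚ_p]d}` with finite index, any `ℤ_p`-extension, any `p`). -/

section RubinShape

variable {R : Type*} [CommRing R] {k : Type*} [Field k] {M : Type*} [AddCommGroup M] [Module R M]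

/-- iterated torsion-freeness -/
theorem pow_smul_eq_zero_imp {a : R} (htor : ∀ m : M, a • m = 0 → m = 0) :
    ∀ (n : ℕ) (m : M), a ^ n • m = 0 → m = 0 := by
  intro n
  induction n with
  | zero => intro m h; simpa using h
  | succ n ih =>
    intro m h
    rw [pow_succ, mul_smul] at h
    exact htor m (ih (a • m) h)

/-- **Rank one + no `a`-torsion + a non-degenerate `χ`-functional ⟹ `CyclicUpToChar`.** -/
theorem cyclicUpToChar_of_rankOne {χ : R →+* k} {a : R} (ha : χ a = 0)
    (hfac : ∀ s : R, s ≠ 0 → ∃ (n : ℕ) (s' : R), χ s' ≠ 0 ∧ s = a ^ n * s')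
    (htor : ∀ m : M, a • m = 0 → m = 0)
    {m₀ : M} (hrk : ∀ m : M, ∃ s r : R, s ≠ 0 ∧ s • m = r • m₀)
    {g : M →+ k} (hg : IsCharFunctional χ g) (hg0 : g m₀ ≠ 0) :
    CyclicUpToChar χ m₀ := by
  intro m
  obtain ⟨s, r, hs, h⟩ := hrk m
  obtain ⟨n, s', hs', rfl⟩ := hfac s hs
  by_cases hr : r = 0
  · subst hr
    rw [zero_smul, mul_smul] at h
    have := pow_smul_eq_zero_imp htor n _ h
    exact ⟨s', 0, hs', by rw [this, zero_smul]⟩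
  obtain ⟨j, r', hr', rfl⟩ := hfac r hr
  rcases Nat.lt_or_ge j n with hjn | hnj
  swap
  · -- `n ≤ j`: cancel `aⁿ`
    obtain ⟨i, rfl⟩ := Nat.exists_eq_add_of_le hnj
    refine ⟨s', a ^ i * r', hs', ?_⟩
    have h' : a ^ n • (s' • m - (a ^ i * r') • m₀) = 0 := by
      rw [smul_sub, ← mul_smul, ← mul_smul, ← mul_assoc, ← pow_add, h, sub_self]
    exact sub_eq_zero.mp (pow_smul_eq_zero_imp htor n _ h')
  · -- `j < n`: impossible, `g` would vanish at `m₀`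
    exfalso
    obtain ⟨i, rfl⟩ := Nat.exists_eq_add_of_lt hjn
    rw [add_assoc] at h
    have h' : a ^ j • ((a ^ (i + 1) * s') • m - r' • m₀) = 0 := by
      rw [smul_sub, ← mul_smul, ← mul_smul, ← mul_assoc, ← pow_add, h, sub_self]
    have h'' : (a ^ (i + 1) * s') • m = r' • m₀ :=
      sub_eq_zero.mp (pow_smul_eq_zero_imp htor j _ h')
    have key := hg.apply_mul_eq h''
    rw [map_mul, map_pow, ha, zero_pow (Nat.succ_ne_zero i), zero_mul, zero_mul] at key
    exact mul_ne_zero hr' hg0 key.symm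

end RubinShape

/-! ## §3  Linear-algebra avatars of the named facts (mechanism lemmas) -/

section LinAlg

open Module

variable {K : Type*} [Field K] {V W : Type*} [AddCommGroup V] [Module K V]
  [AddCommGroup W] [Module K W]

/-- N1 mechanism: the `ρ`-coinvariants inject (descent, Nekovář 8.4.8.2 (i)) into
`H¹(ℚ₂, V_ρ)`, which is a line (N3) ⟹ the coinvariants have dimension `≤ 1`. -/
theorem finrank_le_one_of_injective_into_line [Module.Finite K W] (f : V →ₗ[K] W)
    (hf : Function.Injective f) (hW : finrank K W = 1) : finrank K V ≤ 1 := by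
  have := LinearMap.finrank_le_finrank_of_injective (f := f) hf
  omega

/-- Multiplicity one in the language of duals: on a space of dimension `≤ 1` every linear
functional is a multiple of any non-zero one. -/
theorem dual_proportional_of_finrank_le_one [FiniteDimensional K V] (hV : finrank K V ≤ 1)
    (f g : Module.Dual K V) (hg : g ≠ 0) : ∃ c : K, f = c • g := by
  have hd : finrank K (Module.Dual K V) = finrank K V := Subspace.dual_finrank_eq
  have hpos : 0 < finrank K (Module.Dual K V) :=
    Module.finrank_pos_iff_exists_ne_zero.mpr ⟨g, hg⟩
  have h1 : finrank K (Module.Dual K V) = 1 := by omega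
  obtain ⟨c, hc⟩ := (finrank_eq_one_iff_of_nonzero' g hg).mp h1 f
  exact ⟨c, hc.symm⟩

/-- N3 bookkeeping (Tate's local Euler–Poincaré characteristic at `ℚ₂`, `dim V = 1`):
`h⁰ − h¹ + h² = −[ℚ₂:ℚ₂]·dim V = −1`, `h⁰(V) = 0` (the character `cyclo·ρ⁻¹` is non-trivial),
`h²(V) = h⁰(V*(1)) = 0` (`ρ` has infinite order) ⟹ `h¹ = 1`. -/
theorem h1_eq_one_of_eulerPoincare (h0 h1 h2 : ℕ) (hEP : (h0 : ℤ) - h1 + h2 = -1)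
    (hh0 : h0 = 0) (hh2 : h2 = 0) : h1 = 1 := by
  omega

/-- N3 mechanism: `H¹_f ⊆ H¹` with `dim H¹_f = dim D_dR/Fil⁰ + h⁰ = 1 = dim H¹`
(Bloch–Kato Cor. 3.8.4) ⟹ `H¹_f = H¹`. -/
theorem h1f_eq_top [FiniteDimensional K V] (H1f : Submodule K V)
    (h : finrank K H1f = finrank K V) : H1f = ⊤ :=
  Submodule.eq_top_of_finrank_eq h

end LinAlg

/-! ## §4  The typed receptacle: one `LocalTwistPackage` per dyadic key, one `Member` per curve

DICTIONARY (Rubin 1992 §7 via Agboola 2007 §9 ↦ here ↦ k3-g24's `OutOfRangeFrame`):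
* `K`, `p > 7` good ordinary, `𝔭 ∤ 𝔣`  ↦  `K₀ = ℚ(√−7)`, `p = 2 = v v̄`, `W = A^{(d)}` additive at 2;
* the `𝔭*`-tower `𝒦*_∞ = K(E[𝔭̄^∞])` localised at `𝔭` (unramified)  ↦  `T(key) = ℚ₂^{nr,2^∞}·ℚ₂(√d)`
  (`ψ̄_A(𝔭) ∈ ℤ₂ˣ` is pro-2, so `ρ_W|_{G_{ℚ₂}}` factors through `Gal(T(key)/ℚ₂) ≅ ℤ₂ × ℤ/2`;
  the member's own tower `T_w(W) ⊇ T(key)` is collapsed by the norm `N_{T_w(W)/T(key)}`, through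
  which BOTH functionals factor: corestriction is transitive, and `π_* μ_{log u} = μ_{log N u}`);
* `U*_{∞,𝔭}`  ↦  `M = U_∞(T(key))` (= `H¹_Iw(ℚ₂, ℤ₂(1))` over `T(key)`; the valuation parts die
  in the unramified limit), `Λ = ℤ_p⟦𝒢⟧`  ↦  `R = Λ(key)`, `ψ*`  ↦  `χ = ρ(key)`;
* Thm 7.2 (i) «`U*_∞` has no `ϑ*`-torsion»  ↦  `htor` (Nekovář 8.11.5 (ii), any `p`);
* Rubin's explicit constant `N(𝔣)⁻¹(p−1)(1−ψ*(𝔭)/p)` (Agboola Thm 9.5)  ↦  the INEXPLICIT `C(key)`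
  of `proportional_of_cyclicUpToChar` — this is the transfer: explicit reciprocity ↦ multiplicity one;
* `logTw`  ↦  k3-g24 `F.logLoc` as a function of the local unit image; `lam`  ↦  `F.unitLog.integral F.ρ`;
  `cKLF`  ↦  atom A's constant (`KLFValue`: `F.val = c_KLF · F.unitLog.integral F.ρ`), key-only in norm.
-/

section Receptacle

variable (R : Type*) [CommRing R] (k : Type*) [Field k] (M : Type*) [AddCommGroup M] [Module R M]

/-- D1. The twisted local Iwasawa package of ONE dyadic key `(d mod 2, d′ mod 8)`.
Fields `cyc` (N1, multiplicity one) and `lam_ne` (N2′, the Riemann-sum functional is not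
identically zero on `U_∞(T(key))`) are the two NAMED FACTS; everything else is data. -/
structure LocalTwistPackage where
  /-- the character `ρ(key) : Λ(key) → 𝕜` (unramified part `Frob ↦ ψ̄_A(𝔭)`, times `sgn_{ℚ₂(√d)}`) -/
  χ : R →+* k
  /-- `u ↦ log_ω (tw_ρ u)` : descent to `H¹(ℚ₂, ℤ₂(1)(ρ⁻¹)) = H¹(ℚ₂, T_𝔭W) = H¹_f`, then `log_ω` -/
  logTw : M →+ k
  logTw_semi : IsCharFunctional χ logTw
  /-- `u ↦ ∫ ρ dμ_{log u}` (Riemann sums; `GroupDistribution.tendsto_riemannSum_integral`) -/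
  lam : M →+ k
  lam_semi : IsCharFunctional χ lam
  /-- a test family of norm-coherent units -/
  u₀ : M
  /-- N2′: `lam` is not identically zero (finite falsifier per key: one Riemann sum mod `2ⁿ`) -/
  lam_ne : lam u₀ ≠ 0
  /-- N1: MULTIPLICITY ONE — `U_∞(T(key))` is cyclic up to `ρ`-regular denominators
  (Greenberg Prop. 1 / Cor. 1: rank one per sign, no Λ-torsion + descent 8.4.8.2 (i) +
  `dim H¹(ℚ₂, ℚ₂(1)(ρ⁻¹)) = 1`) -/
  cyc : CyclicUpToChar χ u₀
  /-- atom A's constant `c_KLF(key)` (Gauss sum `τ(χ̄_{d,v})`, `N(𝔣)`, `(1 − ψ*(𝔭)/2)`; k3-g24 `KLFValue`) -/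
  cKLF : k
  cKLF_ne : cKLF ≠ 0

variable {R k M}

/-- D2. A member `W` of the key class, seen through the package: `u` = the norm to `T(key)` of
the local image at `w ∣ v` of `W`'s elliptic-unit family (summed over the finitely many
decomposition cosets with coefficients `ρ(c)` — the same Mackey sum on both sides). -/
structure Member (P : LocalTwistPackage R k M) where
  u : M
  /-- `log_ω(loc_v z_W)` (k3-g24 `F.logLoc`) -/
  logLoc : k
  /-- `∫ ρ_W d(unitLog_W)` (k3-g24 `F.unitLog.integral F.ρ`) -/
  unitLogInt : k
  /-- the Katz–Rubin value of the frame (k3-g24 `F.val`) -/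
  val : k
  /-- DICTIONARY D-log: Kummer/Bloch–Kato + corestriction -/
  logLoc_eq : logLoc = P.logTw u
  /-- DICTIONARY D-int: push-forward of `μ_{log e_W}` along `Gal(T_w(W)/ℚ₂) ↠ Gal(T(key)/ℚ₂)` -/
  unitLogInt_eq : unitLogInt = P.lam u
  /-- atom A (`KLFValue`) -/
  val_eq : val = P.cKLF * unitLogInt

/-- **B, uniformly in the key** (`TwistedKummerLogLaw F_W E(key)` for all members at once):
one constant `C(key)` with `logLoc_W = C(key) · ∫ρ_W d(unitLog_W)` for EVERY member. -/
theorem twistedKummerLogLaw_uniform (P : LocalTwistPackage R k M) :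
    ∃ C : k, ∀ m : Member P, m.logLoc = C * m.unitLogInt := by
  obtain ⟨C, hC⟩ := proportional_of_cyclicUpToChar P.cyc P.logTw_semi P.lam_semi P.lam_ne
  exact ⟨C, fun m => by rw [m.logLoc_eq, m.unitLogInt_eq, hC]⟩

/-- **(2)₂ `OutOfRangeLogLaw`, uniformly in the key**: `logLoc_W = E₂(key) · val_W` with
`E₂(key) = C(key) / c_KLF(key)` the same for all members (k3-g24's `outOfRangeLogLaw_of_atoms`
with its `E` now produced, not assumed). -/
theorem outOfRangeLogLaw_uniform (P : LocalTwistPackage R k M) :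
    ∃ E₂ : k, ∀ m : Member P, m.logLoc = E₂ * m.val := by
  obtain ⟨C, hC⟩ := twistedKummerLogLaw_uniform P
  refine ⟨C / P.cKLF, fun m => ?_⟩
  rw [hC m, m.val_eq, div_mul_eq_mul_div, eq_div_iff P.cKLF_ne]
  ring

/-- The key constant is unique as soon as one member has `val ≠ 0` (any analytic-rank-one
member; this is what makes `E₂(key)` calibratable at ONE anchor per key). -/
theorem outOfRangeLogLaw_const_unique (P : LocalTwistPackage R k M) (m : Member P)
    (hm : m.val ≠ 0) {E E' : k} (hE : ∀ m : Member P, m.logLoc = E * m.val)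
    (hE' : ∀ m : Member P, m.logLoc = E' * m.val) : E = E' :=
  mul_right_cancel₀ hm ((hE m).symm.trans (hE' m))

end Receptacle

section Norms

variable {R : Type*} [CommRing R] {k : Type*} [NormedField k] {M : Type*} [AddCommGroup M]
  [Module R M]

/-- **(2)₂ in NORM currency with a KEY constant** — the shape road RT feeds into the law binder
`∃ eA : ℤ → ℤ → ℤ` of `KatzRubinValueAtTwo` ((a-∃)): `‖logLoc_W‖ = e₂(key) · ‖val_W‖`. -/
theorem norm_logLoc_uniform (P : LocalTwistPackage R k M) :
    ∃ e₂ : ℝ, 0 ≤ e₂ ∧ ∀ m : Member P, ‖m.logLoc‖ = e₂ * ‖m.val‖ := by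
  obtain ⟨E, hE⟩ := outOfRangeLogLaw_uniform P
  exact ⟨‖E‖, norm_nonneg _, fun m => by rw [hE m, norm_mul]⟩

/-- If the key constant has norm in `2^{½ℤ}` and the values have norms `2^{-x}`, the law is an
affine law on exponents with a KEY-ONLY shift — the `eA (d % 2) (d′ % 8)` of the binder. -/
theorem exponent_law_of_norm_law {ι : Type*} (logN valN : ι → ℝ) (e : ℝ) (a : ℤ)
    (he : e = (2 : ℝ) ^ (-(a : ℝ) / 2)) (hlaw : ∀ i, logN i = e * valN i)
    (x : ι → ℤ) (hx : ∀ i, valN i = (2 : ℝ) ^ (-(x i : ℝ) / 2)) :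
    ∀ i, logN i = (2 : ℝ) ^ (-((x i + a : ℤ) : ℝ) / 2) := by
  intro i
  rw [hlaw i, he, hx i, ← Real.rpow_add (by norm_num : (0 : ℝ) < 2)]
  congr 1
  push_cast
  ring

end Norms

/-! ## §5  Model (non-vacuity) and necessity of N1 -/

section Model

/-- A model package over `ℚ`: `χ = id`, `logTw = 3·`, `lam = id`, `u₀ = 1`, `c_KLF = 1`.
Shows the receptacle is inhabited (B32: no vacuous interface). -/
def modelPackage : LocalTwistPackage ℚ ℚ ℚ where
  χ := RingHom.id ℚ
  logTw := AddMonoidHom.mulLeft (3 : ℚ)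
  logTw_semi := by intro r m; simp [mul_left_comm]
  lam := AddMonoidHom.id ℚ
  lam_semi := by intro r m; simp
  u₀ := 1
  lam_ne := by simp
  cyc := by intro m; exact ⟨1, m, by simp, by simp⟩
  cKLF := 1
  cKLF_ne := one_ne_zero

/-- a member of the model key class -/
def modelMember (q : ℚ) : Member modelPackage where
  u := q
  logLoc := 3 * q
  unitLogInt := q
  val := q
  logLoc_eq := by simp [modelPackage]
  unitLogInt_eq := by simp [modelPackage]
  val_eq := by simp [modelPackage]

example : ∃ E₂ : ℚ, ∀ m : Member modelPackage, m.logLoc = E₂ * m.val :=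
  outOfRangeLogLaw_uniform modelPackage

/-- In the model the key constant is `3` (computed, not assumed). -/
example (E : ℚ) (hE : ∀ m : Member modelPackage, m.logLoc = E * m.val) : E = 3 := by
  have := hE (modelMember 1)
  simp [modelMember] at this
  linarith

/-- **N1 is load-bearing**: without multiplicity one, two `χ`-functionals need not be
proportional (`R = ℚ`, `M = ℚ × ℚ`, `f = fst`, `g = snd`, `g (0,1) ≠ 0`). -/
example : ¬ ∃ C : ℚ, ∀ m : ℚ × ℚ,
    (AddMonoidHom.fst ℚ ℚ) m = C * (AddMonoidHom.snd ℚ ℚ) m := by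
  rintro ⟨C, hC⟩
  have := hC (1, 0)
  simp at this

/-- … and indeed `ℚ × ℚ` is not cyclic up to `id`-regular denominators. -/
example : ¬ CyclicUpToChar (RingHom.id ℚ) ((0, 1) : ℚ × ℚ) := by
  intro h
  obtain ⟨s, r, hs, h⟩ := h (1, 0)
  have := congrArg Prod.fst h
  simp at this
  exact hs this

end Model

end Summit.BirchSwinnertonDyer.BirchSwinnertonDyer.Cruxes.SplitBadTwoLowerHalfOfFacts.MultOneK2G25
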